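import Literature.AlgebraicGeometry.Deligne1982.WeilTypeCMSignature
import HarnessLib

/-!
# Cor. 4.2 (a) ⟹ (b) on the carriers for a POLARIZATION (a Kähler multiple): Hodge–Riemann in the `Q_h(z, z̄)` format (Deligne 1982, §4 (4.5), Cor. 4.2)

Layer `Literature/AlgebraicGeometry/Deligne1982`; theorems only (no definition, no named fact).
Companion of `Deligne1982/WeilTypeCMSignature` (`isHyperbolicWeilType_of_hasWeilDiscriminantCM_split`,
which takes Hodge–Riemann in degree one as the hypothesis "`i Q_h(z, z̄) = t ω₀`, `t > 0`, on
`H^{1,0} ∖ 0`"): here that hypothesis is DERIVED for every rational class `h` a non-zero real multiple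
of which is Kähler — Deligne's actual setting, `h` the class of a polarization (p. 33: "a Riemann
form … `ψ(x, Jy)` positive definite") — from the tree's Hodge–Riemann bilinear relation in degree one
(`IsKaehlerClass.hodgeRiemann_one_smul`, Voisin I Thm. 6.32), in the same regime
`∃ s ≠ 0, IsKaehlerClass (dim A) A ((s : ℂ) • h)` as `Deligne1982.exists_hasWeilDiscriminantCM`.

## What is proved (0 sorry)

* `hodgeRiemann_degreeOne_of_isKaehlerClass_smul` — for `X` smooth projective of dimension
  `m + 1 ≥ 2`, `h` rational with `s • h` Kähler (`s ∈ ℝ^×`): there is a non-zero rational top class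
  `ω₀` with `i · Q_h(z, z̄) = t_z ω₀`, `t_z > 0`, for every non-zero `z ∈ H^{1,0}(X)` (the coefficient
  of `Q_h(z, z̄)` along a rational generator is purely imaginary because `\overline{Q_h(z, z̄)} =
  Q_h(z̄, z) = -Q_h(z, z̄)`; its sign is constant by Thm. 6.32 and is absorbed into `ω₀`);
* **`isHyperbolicWeilType_of_hasWeilDiscriminantCM_split_of_isKaehlerClass_smul`** — COR. 4.2 (a) ⟹ (b)
  ON THE CARRIERS FOR A POLARIZATION CLASS: `IsWeilTypeCM A η R e₀ k`, `h` rational with a Kähler real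
  multiple and the Rosati condition, `HasWeilDiscriminantCM A η R e₀ k h [(-1)^k]` ⟹
  `IsHyperbolicWeilType A η (k e₀) h`.

Relies on nothing unproved.

## References

* [Deligne1982HodgeCycles] P. Deligne (notes by J. S. Milne), Hodge cycles on abelian varieties,
  LNM 900 (1982), §4: Cor. 4.2, (4.5) p. 32–33, Lemma 4.6.
* [VoisinHodgeI2002] C. Voisin, Hodge Theory and Complex Algebraic Geometry I (2002), Thm. 6.32, §7.1.2.
-/

noncomputable section

open CategoryTheory Polynomial Module
open Literature.AlgebraicTopology.SingularHomology
open Literature.AlgebraicGeometry.HodgeTheory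
open Literature.AlgebraicGeometry.Motives (AbelianVariety polarizationPairingOne bettiCohomology ComplexPoints
  IsSmoothProjective IsHyperbolicWeilType)
open Literature.AlgebraicGeometry.VanGeemen1994 (pullbackOne)

namespace Literature.AlgebraicGeometry.Deligne1982

/-! ### §1 Hodge–Riemann in degree one for a Kähler multiple, in the `Q_h(z, z̄)` format -/

section HodgeRiemann

variable {X : Motives.SchemeOver ℂ}

/-- Transport of a linear functional on `H^{1+(1+2j)}` to the degree spelling `k` (private copy of
the helper of `WeilTypePeriodPoint`). [folklore] -/
private theorem exists_functional_degree_eq' {j k : ℕ} (hk : 1 + (1 + 2 * j) = k)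
    (τ : complexBetti X (1 + (1 + 2 * j)) →ₗ[ℂ] ℂ) :
    ∃ τ' : complexBetti X k →ₗ[ℂ] ℂ, ∀ (z : complexBetti X 1) (w : complexBetti X (1 + 2 * j)),
      τ' (cupProduct hk z w) = τ (cupProduct rfl z w) := by
  subst hk
  exact ⟨τ, fun _ _ ↦ rfl⟩

/-- **Hodge–Riemann in degree one for a rational class with a Kähler real multiple, in the format
`i Q_h(z, z̄) = t ω₀` (`t > 0`, `ω₀` rational).** For `X` smooth projective of dimension `m + 1 ≥ 2`,
`h ∈ H²` rational and `s • h` Kähler for some real `s ≠ 0`: there is a non-zero rational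
`ω₀ ∈ H^{2m+2}(X(ℂ); ℂ)` with `i · Q_h(z, z̄) = t_z · ω₀`, `t_z > 0`, for every non-zero `z ∈ H^{1,0}(X)`
(`Q_h = h^m ⌣ (· ⌣ ·)`). From Voisin I Thm. 6.32 (the tree's `IsKaehlerClass.hodgeRiemann_one_smul`,
read on `h = s⁻¹ (s h)`): the coefficient of `Q_h(z, z̄)` along a rational generator `ω₁` is purely
imaginary (`\overline{Q_h(z, z̄)} = -Q_h(z, z̄)`), and `i ·` it has a sign independent of `z`, absorbed
into `ω₀ = ± ω₁`. [cite: VoisinHodgeI2002, Thm. 6.32 and §7.1.2] [cite: Deligne1982HodgeCycles, §4 p. 33 (Riemann forms)] -/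
theorem hodgeRiemann_degreeOne_of_isKaehlerClass_smul {m : ℕ} (hm : 1 ≤ m) (hX : IsSmoothProjective (m + 1) X)
    {h : complexBetti X 2} (hh : IsRationalClass h) (hK : ∃ s : ℝ, s ≠ 0 ∧ IsKaehlerClass (m + 1) X ((s : ℂ) • h)) :
    ∃ ω₀ : complexBetti X (2 + 2 * m), IsRationalClass ω₀ ∧ ω₀ ≠ 0 ∧
      ∀ z : complexBetti X 1, IsOfHodgeType (m + 1) X 1 1 0 z → z ≠ 0 →
        ∃ t : ℝ, 0 < t ∧
          Complex.I • polarizationPairingOne X h m z (conjClass (ComplexPoints X) 1 z) = (t : ℂ) • ω₀ := by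
  have h1 := Motives.finrank_complexBetti_two_add_two_mul_eq_one hX
  obtain ⟨ω₁, hω₁, hω₁0⟩ := Motives.exists_isRationalClass_ne_zero_two_add_two_mul hX
  -- Hodge–Riemann (Voisin I Thm. 6.32) for the Kähler class `s • h`, read on `h = s⁻¹ • (s • h)`
  obtain ⟨s, hs, hKs⟩ := hK
  obtain ⟨τ, hτ⟩ := IsKaehlerClass.hodgeRiemann_one_smul (m := m) (X := X) hm hX hKs (inv_ne_zero hs)
  have hsh : ((s⁻¹ : ℝ) : ℂ) • ((s : ℂ) • h) = h := by
    rw [smul_smul, Complex.ofReal_inv, inv_mul_cancel₀ (Complex.ofReal_ne_zero.2 hs), one_smul]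
  rw [hsh] at hτ
  obtain ⟨τ', hτ'⟩ := exists_functional_degree_eq' (show 1 + (1 + 2 * m) = 2 + 2 * m by omega) τ
  -- for `z ∈ H^{1,0} ∖ 0`: `i Q_h(z, z̄) = u ω₁` with `u` real and `u · Re τ'(ω₁) > 0`
  have key : ∀ z : complexBetti X 1, IsOfHodgeType (m + 1) X 1 1 0 z → z ≠ 0 →
      ∃ u : ℝ, Complex.I • polarizationPairingOne X h m z (conjClass (ComplexPoints X) 1 z) = (u : ℂ) • ω₁ ∧
        0 < u * (τ' ω₁).re := by
    intro z hz hz0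
    set q := polarizationPairingOne X h m z (conjClass (ComplexPoints X) 1 z) with hqdef
    set γ : ℂ := lineCoord ω₁ hω₁0 h1 q with hγdef
    have hq : q = γ • ω₁ := (lineCoord_smul_self ω₁ hω₁0 h1 q).symm
    -- `γ` is purely imaginary: `q̄ = Q_h(z̄, z) = -q`
    have hconjq : conjClass (ComplexPoints X) (2 + 2 * m) q = -q := by
      rw [hqdef, conjClass_polarizationPairingOne hh, conjClass_conjClass, polarizationPairingOne_swap]
    have hγ : starRingEnd ℂ γ = -γ := by
      have e1 := hconjq
      rw [hq, conjClass_smul, hω₁.conjClass_eq, ← neg_smul] at e1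
      exact smul_left_injective ℂ hω₁0 e1
    have hIγ : (((Complex.I * γ).re : ℝ) : ℂ) = Complex.I * γ := by
      refine Complex.conj_eq_iff_re.1 ?_
      rw [map_mul, Complex.conj_I, hγ, neg_mul_neg]
    -- Hodge–Riemann at `z`
    have hHR := hτ z hz hz0
    rw [← hτ' z, ← polarizationPairingOne_eq_cupProduct_cupPowTwo, ← hqdef, hq, map_smul, smul_eq_mul,
      ← mul_assoc, ← hIγ, Complex.re_ofReal_mul] at hHR
    refine ⟨(Complex.I * γ).re, ?_, hHR.1⟩
    rw [hq, smul_smul, hIγ]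
  -- the sign of `Re τ'(ω₁)` is absorbed into `ω₀ = ± ω₁`
  by_cases hc : 0 < (τ' ω₁).re
  · refine ⟨ω₁, hω₁, hω₁0, fun z hz hz0 ↦ ?_⟩
    obtain ⟨u, hu, hpos⟩ := key z hz hz0
    refine ⟨u, ?_, hu⟩
    rcases pos_and_pos_or_neg_and_neg_of_mul_pos hpos with ⟨hu0, _⟩ | ⟨_, hc'⟩
    · exact hu0
    · exact absurd hc (not_lt.2 hc'.le)
  · refine ⟨((-1 : ℚ) : ℂ) • ω₁, hω₁.smul _, ?_, fun z hz hz0 ↦ ?_⟩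
    · rw [Rat.cast_neg, Rat.cast_one, neg_one_smul, neg_ne_zero]
      exact hω₁0
    obtain ⟨u, hu, hpos⟩ := key z hz hz0
    rcases pos_and_pos_or_neg_and_neg_of_mul_pos hpos with ⟨_, hc'⟩ | ⟨hu0, _⟩
    · exact absurd hc' hc
    · refine ⟨-u, neg_pos.2 hu0, ?_⟩
      rw [hu, smul_smul]
      congr 1
      push_cast
      ring

end HodgeRiemann

/-! ### §2 Cor. 4.2 (a) ⟹ (b) on the carriers for a polarization class -/

variable {A : AbelianVariety ℂ} {η : A ⟶ A} {R : Polynomial ℤ} {e₀ k : ℕ}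

/-- **Deligne 1982, §4 Cor. 4.2 (a) ⟹ (b) ON THE CARRIERS, for a CM field of any degree and a
POLARIZATION class.** For a Weil-type CM datum `IsWeilTypeCM A η R e₀ k` (`E = ℚ(η)`, `[E:ℚ] = 2e₀`,
`d = dim_E H¹(A, ℚ) = 2k`), a rational class `h` a non-zero real multiple of which is Kähler (the class
of a polarization up to `ℚ^×`; the regime of `Deligne1982.exists_hasWeilDiscriminantCM`) whose Rosati
involution is complex conjugation on `E` (`Q_h(η^*x, y) = -Q_h(x, η^*y)`): if
`disc φ = (-1)^{d/2}`, i.e. `HasWeilDiscriminantCM A η R e₀ k h [(-1)^k]`, then `(A, η)` is of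
HYPERBOLIC Weil type in half-dimension `k·e₀` for `h` (`Motives.IsHyperbolicWeilType`). The signature
condition `a_τ = b_τ` of (a) is automatic under Weil type ((4.5), `exists_orthogonalBasis_card_pos_eq`),
Hodge–Riemann in degree one being `hodgeRiemann_degreeOne_of_isKaehlerClass_smul`.
[cite: Deligne1982HodgeCycles, §4 Cor. 4.2, (4.5) p. 32–33 and Lemma 4.6] [cite: VoisinHodgeI2002, Thm. 6.32] -/
theorem isHyperbolicWeilType_of_hasWeilDiscriminantCM_split_of_isKaehlerClass_smul [Fact (Irreducible (cmPolyQ R))]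
    [Fact (Irreducible (realPolyQ R))] (hW : IsWeilTypeCM A η R e₀ k) {h : complexBetti A.X 2}
    (hQ : IsRationalClass h)
    (hros : ∀ x y : complexBetti A.X 1,
      polarizationPairingOne A.X h (A.dim - 1) (pullbackOne A η x) y =
        -polarizationPairingOne A.X h (A.dim - 1) x (pullbackOne A η y))
    (hK : ∃ s : ℝ, s ≠ 0 ∧ IsKaehlerClass A.dim A.X ((s : ℂ) • h))
    (hδ : HasWeilDiscriminantCM A η R e₀ k h (QuotientGroup.mk ((-1 : (realField R)ˣ) ^ k))) :
    IsHyperbolicWeilType A η (k * e₀) h := by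
  have h2 := hW.two_le_dim
  have hA : A.dim = A.dim - 1 + 1 := by omega
  have hK' : ∃ s : ℝ, s ≠ 0 ∧ IsKaehlerClass (A.dim - 1 + 1) A.X ((s : ℂ) • h) := by rw [← hA]; exact hK
  exact isHyperbolicWeilType_of_hasWeilDiscriminantCM_split hW hQ hros
    (hodgeRiemann_degreeOne_of_isKaehlerClass_smul (by omega) (Motives.isSmoothProjective_of_dim_eq' hA) hQ hK') hδ

end Literature.AlgebraicGeometry.Deligne1982

end
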